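import Mathlib

/-!
# Tier 3, T3.2 — R-B.3: the Iwasawa dictionary at FINITE LEVEL on the kernel
`O[Γ/Γ^m] ≅ O[X]/(X^m − 1) ≅ O[X]/((X + 1)^m − 1)` (γ ↦ X, resp. γ ↦ 1 + X) and «evaluation at ν ↦ ν(γ) − 1»
(seat t3-p3, gen 16)

Blind re-derivation cell `pub-hodge-repro`, Tier-3 seat `t3-p3` (route/TIER3.md §3 row R-B, sub-row R-B.3 «CLOSED (Lang)»;
§6 L63; proofs/t3-p4/R-B3-DICTIONARY.md on Lang, *Cyclotomic Fields I and II*, GTM 121, Ch. 4 §1: `O[[Γ]] ≅ O[[X]]`,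
`γ ↦ 1 + X`, and the evaluation of a measure at a finite-order character `ν` is the evaluation of its power series at
`ν(γ) − 1`).  The lane's census (ADDENDUM-7 §A31 (6), gens 13–15) listed the dictionary among «what stays on paper»:
there is no completed group algebra in Mathlib.  What IS elementary is the dictionary at every FINITE level, which is
the first step of Lang's proof: for `Γ_n := Γ/Γ^{m}` cyclic of order `m` with generator `γ` (on the degree-one line
`Γ ≅ ℤ_p`, `m = p^n`), the group algebra `O[Γ_n]` is `O[X]/(X^m − 1)` via `γ ↦ X`, equivalently `O[X]/((X+1)^m − 1)`
via `γ ↦ 1 + X`, and a character `ν : Γ_n → B^×` pushes the group-ring element `mk P` to the value `P(ν(γ))`, resp.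
`mk Q` to `Q(ν(γ) − 1)`.  The passage to the limit `O[[Γ]] = lim_n O[Γ_n] ≅ O[[X]]` stays on the page.

The cyclic group is `Multiplicative (ZMod m)` with generator `γ = ofAdd 1`; the group algebra is
`MonoidAlgebra O (Multiplicative (ZMod m))`; the quotients are `AdjoinRoot (X ^ m - 1)` and `AdjoinRoot ((X + 1) ^ m - 1)`
over a commutative ring `O`; `m ≠ 0`.

* `exists_monoidHom_ofAdd_one_eq`, `monoidHom_apply_ofAdd`, `monoidHom_ext_ofAdd_one`, `monoidHom_ofAdd_one_pow` —
  the characters of `Γ_n` with values in a commutative monoid `S` are exactly the `m`-th roots of unity of `S`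
  (`ν ↔ ν(γ)`): the finite-level `Ξ_n ≅ μ_{p^n}` of R-B.3's «ν ↔ ζ dictionary»;
* `eval₂_of_ofAdd_one_X_pow_sub_one`, `liftAlgHom_X_pow_sub_one_bijective` — `O[X]/(X^m − 1) ≅ O[Γ_n]`, `X ↦ γ`;
* `lift_liftAlgHom_mk_X_pow_sub_one` — the character `ν` evaluates the group-ring element `mk P` to `P(ν(γ))`;
* `eval₂_of_ofAdd_one_sub_one`, `liftAlgHom_X_add_one_pow_sub_one_bijective` — `O[X]/((X+1)^m − 1) ≅ O[Γ_n]`, `1 + X ↦ γ`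
  (Lang's normalisation);
* `lift_liftAlgHom_mk_X_add_one_pow_sub_one` — **evaluation at `ν(γ) − 1`**: `ν` evaluates `mk Q` to `Q(ν(γ) − 1)`.

HONESTY.  Everything here is finite group-ring algebra over an arbitrary commutative ring; no limit, no topology, no
measure, no `p`.  The identification of the Katz measure's image in `O[Γ_n]` with a polynomial, the limit
`O[[Γ]] ≅ O[[X]]`, and every printed theorem of R-B stay on the page.  TIER3.md §3 R-B's verdict (DECLARED) is unchanged.  Nothing
here says anything about the status of the Hodge conjecture for CM abelian varieties, which is NOT proved.
-/

set_option autoImplicit false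

namespace Summit.Ventures.HodgeRepro.T3.R2Pinning

open Polynomial

section Characters

variable {m : ℕ} [NeZero m] {S : Type*} [CommMonoid S]

/-- Every element of the cyclic group `Γ_n = Multiplicative (ZMod m)` is a power of the generator `γ = ofAdd 1`:
`ofAdd a = γ ^ a.val`. -/
theorem ofAdd_eq_ofAdd_one_pow (a : ZMod m) :
    Multiplicative.ofAdd a = Multiplicative.ofAdd (1 : ZMod m) ^ a.val := by
  rw [← ofAdd_nsmul, nsmul_eq_mul, mul_one, ZMod.natCast_zmod_val]

omit [NeZero m] in
/-- The generator has order dividing `m`: `γ ^ m = 1`. -/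
theorem ofAdd_one_pow_card : Multiplicative.ofAdd (1 : ZMod m) ^ m = (1 : Multiplicative (ZMod m)) := by
  rw [← ofAdd_nsmul, nsmul_eq_mul, mul_one, ZMod.natCast_self, ofAdd_zero]

/-- A character of `Γ_n` is determined by its value at the generator: `ν (ofAdd a) = ν γ ^ a.val`. -/
theorem monoidHom_apply_ofAdd (ν : Multiplicative (ZMod m) →* S) (a : ZMod m) :
    ν (Multiplicative.ofAdd a) = ν (Multiplicative.ofAdd (1 : ZMod m)) ^ a.val := by
  rw [ofAdd_eq_ofAdd_one_pow a, map_pow]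

/-- Two characters of `Γ_n` agreeing at the generator are equal. -/
theorem monoidHom_ext_ofAdd_one {ν₁ ν₂ : Multiplicative (ZMod m) →* S}
    (h : ν₁ (Multiplicative.ofAdd (1 : ZMod m)) = ν₂ (Multiplicative.ofAdd (1 : ZMod m))) : ν₁ = ν₂ := by
  refine MonoidHom.ext fun g => ?_
  rw [← ofAdd_toAdd g, monoidHom_apply_ofAdd ν₁, monoidHom_apply_ofAdd ν₂, h]

omit [NeZero m] in
/-- The value of a character at the generator is an `m`-th root of unity. -/
theorem monoidHom_ofAdd_one_pow (ν : Multiplicative (ZMod m) →* S) :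
    ν (Multiplicative.ofAdd (1 : ZMod m)) ^ m = 1 := by
  rw [← map_pow, ofAdd_one_pow_card, map_one]

/-- **`Ξ_n ≅ μ_m` at finite level**: every `m`-th root of unity `u` of `S` is the value at the generator of a
(unique, by `monoidHom_ext_ofAdd_one`) character of `Γ_n`, namely `ofAdd a ↦ u ^ a.val`. -/
theorem exists_monoidHom_ofAdd_one_eq (u : S) (hu : u ^ m = 1) :
    ∃ ν : Multiplicative (ZMod m) →* S, ν (Multiplicative.ofAdd (1 : ZMod m)) = u := by
  refine ⟨{ toFun := fun g => u ^ (Multiplicative.toAdd g).val, map_one' := ?_, map_mul' := ?_ }, ?_⟩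
  · simp only [toAdd_one, ZMod.val_zero, pow_zero]
  · intro g h
    simp only [toAdd_mul, ZMod.val_add]
    rw [← pow_eq_pow_mod _ hu, pow_add]
  · simp only [MonoidHom.coe_mk, OneHom.coe_mk, toAdd_ofAdd, ZMod.val_one_eq_one_mod]
    rw [← pow_eq_pow_mod _ hu, pow_one]

end Characters

section GroupRing

variable (O : Type*) [CommRing O] (m : ℕ) [NeZero m]

omit [NeZero m] in
/-- `eval₂` along `Algebra.ofId` is `aeval` (the form `AdjoinRoot.liftAlgHom` takes its root condition in). -/
theorem eval₂_ofId_eq_aeval {T : Type*} [CommRing T] [Algebra O T] (x : T) (P : O[X]) :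
    P.eval₂ (Algebra.ofId O T) x = aeval x P := by
  rw [aeval_def]; rfl

omit [NeZero m] in
/-- `X ↦ γ` kills `X ^ m - 1`: `γ = of (ofAdd 1)` is a root of `X ^ m - 1` in the group ring `O[Γ_n]`. -/
theorem eval₂_of_ofAdd_one_X_pow_sub_one :
    (X ^ m - 1 : O[X]).eval₂ (Algebra.ofId O (MonoidAlgebra O (Multiplicative (ZMod m))))
      (MonoidAlgebra.of O (Multiplicative (ZMod m)) (Multiplicative.ofAdd (1 : ZMod m))) = 0 := by
  rw [eval₂_ofId_eq_aeval, map_sub, aeval_X_pow, aeval_one,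
    ← map_pow (MonoidAlgebra.of O (Multiplicative (ZMod m))), ofAdd_one_pow_card,
    map_one (MonoidAlgebra.of O (Multiplicative (ZMod m))), sub_self]

/-- **`O[X]/(X^m − 1) ≅ O[Γ_n]` via `X ↦ γ`** (the finite-level Iwasawa dictionary in the `γ ↦ X` normalisation):
Mathlib's `AdjoinRoot.liftAlgHom` along the root `γ` is bijective. -/
theorem liftAlgHom_X_pow_sub_one_bijective :
    Function.Bijective (AdjoinRoot.liftAlgHom (X ^ m - 1 : O[X])
      (Algebra.ofId O (MonoidAlgebra O (Multiplicative (ZMod m))))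
      (MonoidAlgebra.of O (Multiplicative (ZMod m)) (Multiplicative.ofAdd (1 : ZMod m)))
      (eval₂_of_ofAdd_one_X_pow_sub_one O m)) := by
  set φ := AdjoinRoot.liftAlgHom (X ^ m - 1 : O[X])
    (Algebra.ofId O (MonoidAlgebra O (Multiplicative (ZMod m))))
    (MonoidAlgebra.of O (Multiplicative (ZMod m)) (Multiplicative.ofAdd (1 : ZMod m)))
    (eval₂_of_ofAdd_one_X_pow_sub_one O m) with hφ
  have hroot : AdjoinRoot.root (X ^ m - 1 : O[X]) ^ m = 1 := by
    have h := AdjoinRoot.mk_self (f := (X ^ m - 1 : O[X]))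
    rwa [map_sub, map_pow, AdjoinRoot.mk_X, map_one, sub_eq_zero] at h
  obtain ⟨ψ₀, hψ₀⟩ := exists_monoidHom_ofAdd_one_eq (AdjoinRoot.root (X ^ m - 1 : O[X])) hroot
  set ψ := MonoidAlgebra.lift O (AdjoinRoot (X ^ m - 1 : O[X])) (Multiplicative (ZMod m)) ψ₀ with hψ
  refine Function.bijective_iff_has_inverse.2 ⟨ψ, ?_, ?_⟩
  · -- ψ ∘ φ = id on O[X]/(X^m − 1): both are O-algebra maps sending `root` to `root`.
    have h : ψ.comp φ = AlgHom.id O (AdjoinRoot (X ^ m - 1 : O[X])) := by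
      apply AdjoinRoot.algHom_ext
      rw [AlgHom.comp_apply, hφ, AdjoinRoot.liftAlgHom_root, hψ, MonoidAlgebra.lift_of, hψ₀, AlgHom.id_apply]
    intro x
    exact DFunLike.congr_fun h x
  · -- φ ∘ ψ = id on O[Γ_n]: both send `of g` to `of g`.
    have h : φ.comp ψ = AlgHom.id O (MonoidAlgebra O (Multiplicative (ZMod m))) := by
      apply (MonoidAlgebra.lift O (MonoidAlgebra O (Multiplicative (ZMod m))) (Multiplicative (ZMod m))).symm.injective
      apply monoidHom_ext_ofAdd_one
      simp only [MonoidAlgebra.lift_symm_apply, AlgHom.comp_apply, AlgHom.id_apply]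
      rw [← MonoidAlgebra.of_apply, hψ, MonoidAlgebra.lift_of, hψ₀, hφ, AdjoinRoot.liftAlgHom_root]
    intro y
    exact DFunLike.congr_fun h y

omit [NeZero m] in
/-- **The character `ν` evaluates the group-ring element `mk P` to `P(ν(γ))`**: for a commutative `O`-algebra `B`
and `ν : Γ_n →* B`, `(lift ν) (liftAlgHom (mk P)) = aeval (ν γ) P`. -/
theorem lift_liftAlgHom_mk_X_pow_sub_one {B : Type*} [CommRing B] [Algebra O B]
    (ν : Multiplicative (ZMod m) →* B) (P : O[X]) :
    MonoidAlgebra.lift O B (Multiplicative (ZMod m)) ν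
      (AdjoinRoot.liftAlgHom (X ^ m - 1 : O[X])
        (Algebra.ofId O (MonoidAlgebra O (Multiplicative (ZMod m))))
        (MonoidAlgebra.of O (Multiplicative (ZMod m)) (Multiplicative.ofAdd (1 : ZMod m)))
        (eval₂_of_ofAdd_one_X_pow_sub_one O m) (AdjoinRoot.mk _ P)) =
      aeval (ν (Multiplicative.ofAdd (1 : ZMod m))) P := by
  rw [AdjoinRoot.liftAlgHom_mk, eval₂_ofId_eq_aeval, ← Polynomial.aeval_algHom_apply, MonoidAlgebra.lift_of]

omit [NeZero m] in
/-- `1 + X ↦ γ` kills `(X + 1) ^ m - 1`: `γ − 1` is a root of `(X + 1) ^ m - 1` in `O[Γ_n]` (Lang's normalisation). -/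
theorem eval₂_of_ofAdd_one_sub_one :
    ((X + 1) ^ m - 1 : O[X]).eval₂ (Algebra.ofId O (MonoidAlgebra O (Multiplicative (ZMod m))))
      (MonoidAlgebra.of O (Multiplicative (ZMod m)) (Multiplicative.ofAdd (1 : ZMod m)) - 1) = 0 := by
  rw [eval₂_ofId_eq_aeval, map_sub, map_pow, map_add, aeval_X, aeval_one, sub_add_cancel,
    ← map_pow (MonoidAlgebra.of O (Multiplicative (ZMod m))), ofAdd_one_pow_card,
    map_one (MonoidAlgebra.of O (Multiplicative (ZMod m))), sub_self]

/-- **`O[X]/((X+1)^m − 1) ≅ O[Γ_n]` via `1 + X ↦ γ`** — the finite-level Iwasawa dictionary in Lang's normalisation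
`γ ↦ 1 + X`: `AdjoinRoot.liftAlgHom` along the root `γ − 1` is bijective. -/
theorem liftAlgHom_X_add_one_pow_sub_one_bijective :
    Function.Bijective (AdjoinRoot.liftAlgHom ((X + 1) ^ m - 1 : O[X])
      (Algebra.ofId O (MonoidAlgebra O (Multiplicative (ZMod m))))
      (MonoidAlgebra.of O (Multiplicative (ZMod m)) (Multiplicative.ofAdd (1 : ZMod m)) - 1)
      (eval₂_of_ofAdd_one_sub_one O m)) := by
  set φ := AdjoinRoot.liftAlgHom ((X + 1) ^ m - 1 : O[X])
    (Algebra.ofId O (MonoidAlgebra O (Multiplicative (ZMod m))))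
    (MonoidAlgebra.of O (Multiplicative (ZMod m)) (Multiplicative.ofAdd (1 : ZMod m)) - 1)
    (eval₂_of_ofAdd_one_sub_one O m) with hφ
  have hroot : (AdjoinRoot.root ((X + 1) ^ m - 1 : O[X]) + 1) ^ m = 1 := by
    have h := AdjoinRoot.mk_self (f := ((X + 1) ^ m - 1 : O[X]))
    rwa [map_sub, map_pow, map_add, AdjoinRoot.mk_X, map_one, sub_eq_zero] at h
  obtain ⟨ψ₀, hψ₀⟩ := exists_monoidHom_ofAdd_one_eq (AdjoinRoot.root ((X + 1) ^ m - 1 : O[X]) + 1) hroot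
  set ψ := MonoidAlgebra.lift O (AdjoinRoot ((X + 1) ^ m - 1 : O[X])) (Multiplicative (ZMod m)) ψ₀ with hψ
  refine Function.bijective_iff_has_inverse.2 ⟨ψ, ?_, ?_⟩
  · have h : ψ.comp φ = AlgHom.id O (AdjoinRoot ((X + 1) ^ m - 1 : O[X])) := by
      apply AdjoinRoot.algHom_ext
      rw [AlgHom.comp_apply, hφ, AdjoinRoot.liftAlgHom_root, map_sub, map_one ψ, hψ, MonoidAlgebra.lift_of, hψ₀,
        add_sub_cancel_right, AlgHom.id_apply]
    intro x
    exact DFunLike.congr_fun h x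
  · have h : φ.comp ψ = AlgHom.id O (MonoidAlgebra O (Multiplicative (ZMod m))) := by
      apply (MonoidAlgebra.lift O (MonoidAlgebra O (Multiplicative (ZMod m))) (Multiplicative (ZMod m))).symm.injective
      apply monoidHom_ext_ofAdd_one
      simp only [MonoidAlgebra.lift_symm_apply, AlgHom.comp_apply, AlgHom.id_apply]
      rw [← MonoidAlgebra.of_apply, hψ, MonoidAlgebra.lift_of, hψ₀, map_add, map_one φ, hφ,
        AdjoinRoot.liftAlgHom_root, sub_add_cancel]
    intro y
    exact DFunLike.congr_fun h y

omit [NeZero m] in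
/-- **Evaluation at `ν(γ) − 1`** (R-B.3's dictionary at finite level, Lang GTM 121 Ch. 4 §1): the character `ν`
evaluates the group-ring element `mk Q` (read through `O[X]/((X+1)^m − 1) ≅ O[Γ_n]`) to `Q(ν(γ) − 1)`. -/
theorem lift_liftAlgHom_mk_X_add_one_pow_sub_one {B : Type*} [CommRing B] [Algebra O B]
    (ν : Multiplicative (ZMod m) →* B) (Q : O[X]) :
    MonoidAlgebra.lift O B (Multiplicative (ZMod m)) ν
      (AdjoinRoot.liftAlgHom ((X + 1) ^ m - 1 : O[X])
        (Algebra.ofId O (MonoidAlgebra O (Multiplicative (ZMod m))))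
        (MonoidAlgebra.of O (Multiplicative (ZMod m)) (Multiplicative.ofAdd (1 : ZMod m)) - 1)
        (eval₂_of_ofAdd_one_sub_one O m) (AdjoinRoot.mk _ Q)) =
      aeval (ν (Multiplicative.ofAdd (1 : ZMod m)) - 1) Q := by
  rw [AdjoinRoot.liftAlgHom_mk, eval₂_ofId_eq_aeval, ← Polynomial.aeval_algHom_apply, map_sub,
    map_one (MonoidAlgebra.lift O B (Multiplicative (ZMod m)) ν), MonoidAlgebra.lift_of]

end GroupRing

end Summit.Ventures.HodgeRepro.T3.R2Pinning
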